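import Summits.QuantumFields.YangMills.Theorems.LuscherReductionTwistedTraceScalingCovGradInjective
import Summits.QuantumFields.YangMills.Theorems.LuscherReductionTwistedTraceScalingVacuumHodge
import Summits.QuantumFields.YangMills.Theorems.LuscherReductionTwistedTraceScalingBOShellCoercive
import Summits.QuantumFields.YangMills.Theorems.LuscherReductionTwistedTraceScalingBOCentralChart
import HarnessLib


/-!
# R56 (crux `TwistedTraceScaling`, stmt-QuantumFields-20203): STIFF SEPARATION — the stiff leak of a gauge direction is `O(τ)` times its OWN gauge component
# (the `[u_k − 1, ξ]` cross term is a constant mode plus a Poincaré-controlled fluctuation), and the slack a stiff-separation inequality must carry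
# (pure gauges of zero kinetic defect have stiff chart component `≍ ‖x'‖²`)

Standing disprover `ym-cdisprove-20203-1` (gen 45), answering lane A's `disprover-wanted` (`pub/ym-fleet/INBOX.md` 2026-08-29T11:55Z, `ym-luscher-20007-p1` g19 PROGRESS 3):
"is STIFF SEPARATION (COARSE-DESIGN §30.6 (d)) TRUE at `s ∈ (1/6, 1/4)` — the `[u_k − 1, ξ]` cross term is `β^{-2s} ≫ β^{-1/2}` unless the covariant split is used?"
VERDICT (no kill; this file is the Lean spine of the answer): the cross term is harmless in BOTH splits, and the only slack a stiff-separation inequality must carry on the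
chart ball comes from GAUGE COPIES OF THE CENTRE (zero kinetic defect, quartic stiff chart component) — which forces the restriction of (d) to GAUGE-NEAR `U` that lane A
already has (`‖P_Γ x'‖ ≤ β^{-1}ℓ`; gauge-far handled by `χ ≤ e^{−ℓ²}`).
* §1 `norm_covCurl_one_sq_le_stiffProj` — `‖d v‖² ≤ 96·‖P_s v‖²` (`v − P_s v ∈ ker d`; `…BOCentralChart.norm_latCurl_sq_le`): a curl certifies a stiff component.
* §2 ★ the cross term.  `covGradL_const_mem_constModes`: for a CONSTANT colour field `c`, `D_u c = ((Ad(u_k) − 1)c)_{(x,k)}` is a constant mode (an infinitesimal colour rotation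
  of the slow variable `u`), hence `P_s (D_u c) = 0 = P_Γ (D_u c)` EXACTLY — the `O(τ·|ξ̄|) = O(β^{-2s})` term never reaches the stiff sector, in either split.
  `norm_stiffProj_covGradL_le`: `‖P_s (D_u ξ)‖ = ‖P_s ((D_u − ∇)(ξ − c))‖ ≤ 12√(3|E|)·τ·‖ξ − c‖∞` for EVERY constant `c` (`…CovGradInjective.norm_covGradL_sub_vacGrad_le`), and with
  the torus Poincaré constant `C` (`…norm_le_proj_vacGrad`), `12√(3|E|)τC ≤ 1/2`: ★★★ `norm_stiffProj_covGradL_le_gaugeProj` —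
  `‖P_s (D_u ξ)‖ ≤ κ·‖P_Γ (D_u ξ)‖`, `κ := 24√(3|E|)·C·τ = O(L²·τ)`: the stiff LEAK of a gauge direction is `O(τ)` times ITS OWN linearised-gauge component, which the kinetic
  defect pays in full.
* §3 ★★ `linearised_stiff_separation` — pure Hilbert-space algebra on `Γ ⊥ stiff`: `‖P_s w‖ ≤ κ‖P_Γ w‖`, `0 ≤ κ < 1` ⇒ `‖y + w‖² ≥ (1 − κ)‖P_s y‖² − (4κ/3)‖P_Γ y‖²` for every
  `y`.  With `w = D_u ξ` (any `ξ`): the VACUUM split already gives stiff separation at linear order with constant `1 − κ` and slack `(4κ/3)·‖P_Γ(x' − x)‖²`; in lane A's regime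
  (`‖P_Γ x'‖ ≤ β^{-1}ℓ`, `‖x‖ ≤ r_f = ℓβ^{-1/2}`, `τ ≲ Dβ^{-s}`) the slack is `O(L²Dℓ²β^{-s})·β^{-1} = o(β^{-1})`; the covariant split removes even that (leak `0`), leaving only
  second-order chart terms `Q² ~ β^{-2}ℓ⁴` (shell) / `β^{-6s}` (far gauge-near) = `o(β^{-1})` iff `s > 1/6` — consistent with the window `(1/6, 1/5]`.
* §4 ★★ the `L = 2` PURE-GAUGE WITNESS (exact): `g_x = a^{[x₀=1]} b^{[x₁=1]}`, `q(a) = (cos φ, sin φ, 0, 0)`, `q(b) = (cos φ, 0, sin φ, 0)`, `x'_{(x,k)} = u⃗(g_x g_{x+k}⁻¹)`: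
  balanced (every pure gauge is, at `L = 2`: `pureGauge_mem_balancedSet_two`), capped for `sin²φ ≤ 1/4`, `oT 1 x' = 1^g` (`cos φ ≥ 0`), ZERO kinetic defect against the centre
  `oT 1 0 = 1` (`kinDefect_gaugeTransform_self`), zero action, honest chart coordinates (slow mean `1`, `relLinkVec = linkEmbed x'`), `‖x'‖² = 16 sin²φ`, and ONE curl component
  `(d x')_{(0;0<1),2} = −2cos φ sin²φ` (the BCH commutator of the two axis rotations) ⇒ `‖P_s x'‖² ≥ sin⁴φ/32 = ‖x'‖⁴/8192` (numerically `= ‖x'‖⁴/64` exactly).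
* §5 ★★★ NEGATIVE: `not_slackFree_stiffSeparation_two` — no `c > 0` with `kinDefect(oT 1 x', oT 1 x, g) ≥ c‖P_s(x' − x)‖²` on the capped balanced ball × all `g`;
  `slack_ge_of_stiffSeparation_two` — any version with slack `δ` has `δ ≥ c·sin⁴φ/32 = c‖x'‖⁴/8192` along the witness family (`exists_pureGauge_witness_two`).  Read at lane A's
  scales: on GAUGE-FAR far `U` (`‖x'‖ ≍ β^{-s}`) the forced slack is `≍ β^{-4s} ≫ β^{-1}` for `s < 1/4` — (d) cannot be extended there (and is not: `χ ≤ e^{−ℓ²}` covers it); on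
  gauge-near `U` the same mechanism costs only `(β^{-1}ℓ)⁴`.
HONEST FRAMING: helper / tightness lemmas for a stub ((C5)(d) of `COARSE-DESIGN §30`) of a child of the CONDITIONAL reduction route R2b1 (`LuscherReduction`, skeleton
«twolattice»); no verdict on `TwistedTraceScaling` changes; not a gap, not Clay.  bears_on R2b1.  Numerics (pure python, session folder `num/`): L = 2, inf_g kinDefect/‖P_s y‖²
= 0.999/0.997/0.995/0.975 at τ = 0/0.05/0.1/0.2 for stiff displacements; vacuum-split leak `‖P_s D_uξ‖²/‖D_uξ‖² ≈ 0.9τ²`.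
FILE SPLIT: this file = §1–§3 (every `L`); the `L = 2` pure-gauge witness and the negative theorems §4–§5 are `…Negative.StiffSeparationPureGauge` (R56B).
-/

set_option autoImplicit false

noncomputable section

open Real
open scoped BigOperators InnerProductSpace RealInnerProductSpace Quaternion Matrix
open Literature.MathematicalPhysics.QuantumFieldTheory hiding SU2
open Literature.MathematicalPhysics.QuantumLattice
open Summit.QuantumFields.YangMills.Theorems.FemtoTransferGap
open Summit.QuantumFields.YangMills.Theorems.FemtoTransferGap.TwoLattice
open Summit.QuantumFields.YangMills.Theorems.FemtoTransferGap.TwoLattice.Stiff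
open Summit.QuantumFields.YangMills.Theorems.FemtoTransferGap.TwoLattice.Toron
open Summit.QuantumFields.YangMills.Theorems.FemtoTransferGap.TwoLattice.Cov
open Summit.QuantumFields.YangMills.Theorems.FemtoTransferGap.TwoLattice.ConstTube

namespace Summit.QuantumFields.YangMills.Theorems.TwistedTraceScaling.Negative.R56

variable {L : ℕ} [NeZero L]

/-! ## §1 The stiff projection controls the vacuum curl: `‖d v‖² ≤ 96·‖P_s v‖²` -/

/-- The vacuum curl only sees the stiff component: `d(v − P_s v) = 0` (`v − P_s v ∈ (stiffSpace)ᗮ = ker d`). [cite: Luscher1983, §3] -/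
theorem covCurl_one_sub_stiffProj (v : LinkSpace L) :
    covCurl (1 : GaugeConfig 3 L SU2) (v - (stiffSpace L).starProjection v) = 0 := by
  have h : v - (stiffSpace L).starProjection v ∈ (stiffSpace L)ᗮ := Submodule.sub_starProjection_mem_orthogonal v
  rw [stiffSpace, Submodule.orthogonal_orthogonal] at h
  exact LinearMap.mem_ker.mp h

/-- `d v = d (P_s v)`. [cite: Luscher1983, §3] -/
theorem covCurl_one_eq_stiffProj (v : LinkSpace L) :
    covCurl (1 : GaugeConfig 3 L SU2) v = covCurl (1 : GaugeConfig 3 L SU2) ((stiffSpace L).starProjection v) := by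
  have h := covCurl_one_sub_stiffProj v
  rw [map_sub, sub_eq_zero] at h
  exact h

/-- ★ **`‖d v‖² ≤ 96·‖P_s v‖²`** — the stiff component is bounded BELOW by the curl (`…BOCentralChart.norm_latCurl_sq_le`). [folklore] -/
theorem norm_covCurl_one_sq_le_stiffProj (v : LinkSpace L) :
    ‖covCurl (1 : GaugeConfig 3 L SU2) v‖ ^ 2 ≤ 96 * ‖(stiffSpace L).starProjection v‖ ^ 2 := by
  rw [covCurl_one_eq_stiffProj v, covCurl_one]
  exact norm_latCurl_sq_le _

/-- Hence a link field with nonzero vacuum curl has a nonzero stiff component. [folklore] -/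
theorem stiffProj_ne_zero_of_covCurl_ne_zero {v : LinkSpace L} (hv : covCurl (1 : GaugeConfig 3 L SU2) v ≠ 0) :
    (stiffSpace L).starProjection v ≠ 0 := by
  intro h0
  have h := norm_covCurl_one_sq_le_stiffProj v
  rw [h0, norm_zero, zero_pow two_ne_zero, mul_zero] at h
  exact hv (norm_eq_zero.mp (le_antisymm (by nlinarith [norm_nonneg (covCurl (1 : GaugeConfig 3 L SU2) v)]) (norm_nonneg _)))

/-! ## §2 The `[u_k − 1, ξ]` cross term: constant part = constant mode (`⊥ stiff`), fluctuation part = `O(τ)` × the field's own gauge component -/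

/-- The stiff projection kills the constant modes. [cite: Luscher1983, §3] -/
theorem stiffProj_eq_zero_of_mem_constModes {w : LinkSpace L} (hw : w ∈ constModes L) : (stiffSpace L).starProjection w = 0 := by
  rw [Submodule.starProjection_apply_eq_zero_iff, stiffSpace, Submodule.orthogonal_orthogonal]
  exact constModes_le_ker_covCurl_one hw

/-- The stiff projection kills the linearised gauge modes. [cite: Luscher1983, §3] -/
theorem stiffProj_eq_zero_of_mem_gaugeModes {w : LinkSpace L} (hw : w ∈ gaugeModes L) : (stiffSpace L).starProjection w = 0 := by
  rw [Submodule.starProjection_apply_eq_zero_iff, stiffSpace, Submodule.orthogonal_orthogonal]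
  exact gaugeModes_le_ker L hw

/-- `P_s ∇ξ = 0`. [cite: Luscher1983, §3] -/
theorem stiffProj_vacGrad (ξ : Site 3 L → Fin 3 → ℝ) : (stiffSpace L).starProjection (vacGrad L ξ) = 0 :=
  stiffProj_eq_zero_of_mem_gaugeModes (LinearMap.mem_range_self _ ξ)

omit [NeZero L] in
/-- ★ **The covariant gradient of a CONSTANT colour field is a constant mode**: `D_u c = ((Ad(u_k) − 1)c)_{(x,k)}` depends on the direction only — it is the
infinitesimal colour rotation of the slow variable `u` (the `[u_k − 1, ξ̄]` term of COARSE-DESIGN §30.6 (d)). [folklore] -/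
theorem covGradL_const_mem_constModes (u : GaugeConfig 3 1 SU2) (c : Fin 3 → ℝ) :
    covGradL L u (fun _ => c) ∈ constModes L := by
  have h : covGradL L u (fun _ => c) = WithLp.toLp 2 (fun ea : Edge 3 L × Fin 3 => (fun (a k : Fin 3) => ((adRot (u (0, k))).mulVec c) a - c a) ea.2 ea.1.2) := by
    ext ea
    rw [show ea = (ea.1, ea.2) from rfl, covGradL_apply]
  rw [h]
  exact constLink_mem_constModes (L := L) (fun (a k : Fin 3) => ((adRot (u (0, k))).mulVec c) a - c a)

/-- Hence `P_s (D_u c) = 0`: the constant part of the cross term is invisible to the stiff projection. [folklore] -/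
theorem stiffProj_covGradL_const (u : GaugeConfig 3 1 SU2) (c : Fin 3 → ℝ) :
    (stiffSpace L).starProjection (covGradL L u (fun _ => c)) = 0 :=
  stiffProj_eq_zero_of_mem_constModes (covGradL_const_mem_constModes u c)

/-- … and `P_Γ (D_u c) = 0` as well (constants `⊥ Γ`). [folklore] -/
theorem gaugeProj_covGradL_const (u : GaugeConfig 3 1 SU2) (c : Fin 3 → ℝ) :
    (gaugeModes L).starProjection (covGradL L u (fun _ => c)) = 0 :=
  starProjection_gaugeModes_of_mem_constModes (covGradL_const_mem_constModes u c)

omit [NeZero L] in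
/-- Splitting off a constant: `D_u ξ = D_u c + D_u (ξ − c)`. [folklore] -/
theorem covGradL_eq_const_add (u : GaugeConfig 3 1 SU2) (ξ : Site 3 L → Fin 3 → ℝ) (c : Fin 3 → ℝ) :
    covGradL L u ξ = covGradL L u (fun _ => c) + covGradL L u (fun x => ξ x - c) := by
  rw [← map_add]; congr 1; funext x; simp

/-- ★ **The stiff part of a gauge direction is the stiff part of the FLUCTUATION's covariant correction**: `P_s (D_u ξ) = P_s ((D_u − ∇)(ξ − c))` for every constant `c`.
[folklore] -/
theorem stiffProj_covGradL_eq (u : GaugeConfig 3 1 SU2) (ξ : Site 3 L → Fin 3 → ℝ) (c : Fin 3 → ℝ) :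
    (stiffSpace L).starProjection (covGradL L u ξ) =
      (stiffSpace L).starProjection (covGradL L u (fun x => ξ x - c) - vacGrad L (fun x => ξ x - c)) := by
  rw [covGradL_eq_const_add u ξ c, map_add, stiffProj_covGradL_const, zero_add, map_sub, stiffProj_vacGrad, sub_zero]

/-- ★★ **THE LEAK BOUND**: for `|u⃗_k|∞ ≤ τ ≤ 1` and every colour field `ξ` and constant `c`: `‖P_s (D_u ξ)‖ ≤ 12√(3|E|)·τ·‖ξ − c‖∞` — the stiff leak of a gauge direction is
controlled by the OSCILLATION of `ξ`, never by its size. [folklore] -/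
theorem norm_stiffProj_covGradL_le (u : GaugeConfig 3 1 SU2) {τ : ℝ} (hτ1 : τ ≤ 1) (hu : ∀ (k : Fin 3) (a : Fin 3), |vecPart (u (0, k)) a| ≤ τ)
    (ξ : Site 3 L → Fin 3 → ℝ) (c : Fin 3 → ℝ) :
    ‖(stiffSpace L).starProjection (covGradL L u ξ)‖ ≤ 12 * Real.sqrt (3 * Fintype.card (Edge 3 L)) * τ * ‖(fun x => ξ x - c)‖ := by
  rw [stiffProj_covGradL_eq u ξ c]
  exact (Submodule.norm_starProjection_apply_le _ _).trans (norm_covGradL_sub_vacGrad_le L u hτ1 hu _)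

/-- The gauge component of `D_u ξ` is that of the fluctuation: `P_Γ (D_u ξ) = P_Γ (D_u (ξ − c))`. [folklore] -/
theorem gaugeProj_covGradL_eq (u : GaugeConfig 3 1 SU2) (ξ : Site 3 L → Fin 3 → ℝ) (c : Fin 3 → ℝ) :
    (gaugeModes L).starProjection (covGradL L u ξ) = (gaugeModes L).starProjection (covGradL L u (fun x => ξ x - c)) := by
  rw [covGradL_eq_const_add u ξ c, map_add, gaugeProj_covGradL_const, zero_add]

/-- The mean-zero fluctuation of `ξ`. [folklore] -/
theorem sum_sub_mean_eq_zero (ξ : Site 3 L → Fin 3 → ℝ) :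
    ∑ x : Site 3 L, (ξ x - (Fintype.card (Site 3 L) : ℝ)⁻¹ • ∑ y : Site 3 L, ξ y) = 0 := by
  have hN : (Fintype.card (Site 3 L) : ℝ) ≠ 0 := by exact_mod_cast Fintype.card_ne_zero
  rw [Finset.sum_sub_distrib, Finset.sum_const, Finset.card_univ, ← Nat.cast_smul_eq_nsmul ℝ, smul_smul, mul_inv_cancel₀ hN, one_smul, sub_self]

/-- ★★★ **THE LEAK IS `O(τ)` TIMES THE FIELD'S OWN GAUGE COMPONENT**: with the Poincaré constant `C` of the torus (`…CovGradInjective.norm_le_proj_vacGrad`) and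
`12√(3|E|)·τ·C ≤ 1/2`: `‖P_s (D_u ξ)‖ ≤ 24√(3|E|)·C·τ·‖P_Γ (D_u ξ)‖` for EVERY `ξ` (no mean-zero or pinning condition) — in the kinetic defect the gauge component is paid
in full, so the stiff leak of the `[u_k − 1, ξ]` cross term can never exceed `O(τ)` of what is paid. [folklore] -/
theorem norm_stiffProj_covGradL_le_gaugeProj {C τ : ℝ} (hC : 0 < C)
    (hP : ∀ ξ : Site 3 L → Fin 3 → ℝ, ∑ x : Site 3 L, ξ x = 0 → ‖ξ‖ ≤ C * ‖vacGrad L ξ‖)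
    (hτ1 : τ ≤ 1) (hsmall : 12 * Real.sqrt (3 * Fintype.card (Edge 3 L)) * τ * C ≤ 1 / 2)
    (u : GaugeConfig 3 1 SU2) (hu : ∀ (k : Fin 3) (a : Fin 3), |vecPart (u (0, k)) a| ≤ τ) (ξ : Site 3 L → Fin 3 → ℝ) :
    ‖(stiffSpace L).starProjection (covGradL L u ξ)‖ ≤
      24 * Real.sqrt (3 * Fintype.card (Edge 3 L)) * C * τ * ‖(gaugeModes L).starProjection (covGradL L u ξ)‖ := by
  set c : Fin 3 → ℝ := (Fintype.card (Site 3 L) : ℝ)⁻¹ • ∑ y : Site 3 L, ξ y with hc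
  set η : Site 3 L → Fin 3 → ℝ := fun x => ξ x - c with hη
  have hη0 : ∑ x : Site 3 L, η x = 0 := sum_sub_mean_eq_zero ξ
  have hτ0 : 0 ≤ τ := (abs_nonneg _).trans (hu 0 0)
  have h1 : ‖(stiffSpace L).starProjection (covGradL L u ξ)‖ ≤ 12 * Real.sqrt (3 * Fintype.card (Edge 3 L)) * τ * ‖η‖ :=
    norm_stiffProj_covGradL_le u hτ1 hu ξ c
  have h2 : ‖η‖ ≤ 2 * C * ‖(gaugeModes L).starProjection (covGradL L u η)‖ := norm_le_of_proj_covGradL L hC hP hτ1 hsmall u hu η hη0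
  have h3 : (gaugeModes L).starProjection (covGradL L u η) = (gaugeModes L).starProjection (covGradL L u ξ) := (gaugeProj_covGradL_eq u ξ c).symm
  rw [h3] at h2
  calc ‖(stiffSpace L).starProjection (covGradL L u ξ)‖ ≤ 12 * Real.sqrt (3 * Fintype.card (Edge 3 L)) * τ * ‖η‖ := h1
    _ ≤ 12 * Real.sqrt (3 * Fintype.card (Edge 3 L)) * τ * (2 * C * ‖(gaugeModes L).starProjection (covGradL L u ξ)‖) :=
        mul_le_mul_of_nonneg_left h2 (by positivity)
    _ = 24 * Real.sqrt (3 * Fintype.card (Edge 3 L)) * C * τ * ‖(gaugeModes L).starProjection (covGradL L u ξ)‖ := by ring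

/-! ## §3 Linearised stiff separation in the VACUUM split (pure Hilbert-space algebra on `Γ ⊥ stiff`) -/

/-- `P_Γ ∘ P_s = 0` (`stiff ⊥ Γ`). [cite: Luscher1983, §3] -/
theorem gaugeProj_stiffProj (v : LinkSpace L) : (gaugeModes L).starProjection ((stiffSpace L).starProjection v) = 0 := by
  rw [Submodule.starProjection_apply_eq_zero_iff]
  have h : (stiffSpace L).starProjection v ∈ (constModes L ⊔ gaugeModes L)ᗮ := by
    rw [← stiffSpace_eq_orthogonal]; exact Submodule.starProjection_apply_mem _ v
  exact Submodule.orthogonal_le le_sup_right h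

/-- `‖v‖² ≥ ‖P_s v‖² + ‖P_Γ v‖²`. [cite: Luscher1983, §3] -/
theorem norm_sq_ge_stiffProj_add_gaugeProj (v : LinkSpace L) :
    ‖(stiffSpace L).starProjection v‖ ^ 2 + ‖(gaugeModes L).starProjection v‖ ^ 2 ≤ ‖v‖ ^ 2 := by
  rw [Submodule.norm_sq_eq_add_norm_sq_starProjection v (stiffSpace L), Submodule.starProjection_orthogonal_val]
  have h : (gaugeModes L).starProjection (v - (stiffSpace L).starProjection v) = (gaugeModes L).starProjection v := by
    rw [map_sub, gaugeProj_stiffProj, sub_zero]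
  have h2 : ‖(gaugeModes L).starProjection v‖ ≤ ‖v - (stiffSpace L).starProjection v‖ := by
    rw [← h]; exact Submodule.norm_starProjection_apply_le _ _
  nlinarith [norm_nonneg ((gaugeModes L).starProjection v), pow_le_pow_left₀ (norm_nonneg _) h2 2]

/-- Young: `‖a + b‖² ≥ (1 − ε)‖a‖² − (1/ε − 1)‖b‖²` for `0 < ε`. [folklore] -/
theorem norm_add_sq_ge_young (a b : LinkSpace L) {ε : ℝ} (hε : 0 < ε) :
    (1 - ε) * ‖a‖ ^ 2 - (1 / ε - 1) * ‖b‖ ^ 2 ≤ ‖a + b‖ ^ 2 := by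
  rw [norm_add_sq_real]
  have hcs : |⟪a, b⟫| ≤ ‖a‖ * ‖b‖ := abs_real_inner_le_norm a b
  have hab := abs_le.mp hcs
  have hy : 2 * (‖a‖ * ‖b‖) ≤ ε * ‖a‖ ^ 2 + ‖b‖ ^ 2 / ε := by
    have h := two_mul_le_add_sq (Real.sqrt ε * ‖a‖) (‖b‖ / Real.sqrt ε)
    have hs : Real.sqrt ε ≠ 0 := (Real.sqrt_pos.mpr hε).ne'
    calc 2 * (‖a‖ * ‖b‖) = 2 * (Real.sqrt ε * ‖a‖) * (‖b‖ / Real.sqrt ε) := by field_simp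
      _ ≤ (Real.sqrt ε * ‖a‖) ^ 2 + (‖b‖ / Real.sqrt ε) ^ 2 := h
      _ = ε * ‖a‖ ^ 2 + ‖b‖ ^ 2 / ε := by rw [mul_pow, div_pow, Real.sq_sqrt hε.le]
  have : (1 / ε - 1) * ‖b‖ ^ 2 = ‖b‖ ^ 2 / ε - ‖b‖ ^ 2 := by ring
  rw [this]
  nlinarith

/-- ★★ **LINEARISED STIFF SEPARATION (vacuum split)**: if the stiff leak of `w` is at most `κ` times its gauge component (`‖P_s w‖ ≤ κ‖P_Γ w‖`, `0 ≤ κ < 1` — by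
`norm_stiffProj_covGradL_le_gaugeProj` this holds for EVERY gauge direction `w = D_u ξ` with `κ = 24√(3|E|)Cτ`), then for every displacement `y`:
`‖y + w‖² ≥ (1 − κ)‖P_s y‖² − (4κ/3)‖P_Γ y‖²` — the infimum over the gauge directions costs at most the factor `1 − κ` on the stiff part and a slack `κ·(gauge part of y)²`.
[folklore] -/
theorem linearised_stiff_separation {κ : ℝ} (hκ0 : 0 ≤ κ) (hκ1 : κ < 1) (y w : LinkSpace L)
    (hleak : ‖(stiffSpace L).starProjection w‖ ≤ κ * ‖(gaugeModes L).starProjection w‖) :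
    (1 - κ) * ‖(stiffSpace L).starProjection y‖ ^ 2 - 4 * κ / 3 * ‖(gaugeModes L).starProjection y‖ ^ 2 ≤ ‖y + w‖ ^ 2 := by
  set A := ‖(stiffSpace L).starProjection y‖ with hA
  set p := ‖(gaugeModes L).starProjection y‖ with hp
  set a := ‖(gaugeModes L).starProjection w‖ with ha
  set b := ‖(stiffSpace L).starProjection w‖ with hb
  have hA0 : 0 ≤ A := norm_nonneg _
  have hp0 : 0 ≤ p := norm_nonneg _
  have ha0 : 0 ≤ a := norm_nonneg _
  have hb0 : 0 ≤ b := norm_nonneg _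
  have hsplit := norm_sq_ge_stiffProj_add_gaugeProj (y + w)
  rw [map_add, map_add] at hsplit
  rcases hκ0.eq_or_lt with hκ | hκ
  · -- `κ = 0`: no leak at all
    have hb' : (stiffSpace L).starProjection w = 0 := by
      rw [← hκ, zero_mul] at hleak; exact norm_eq_zero.mp (le_antisymm hleak hb0)
    rw [hb', add_zero] at hsplit
    rw [← hκ]
    nlinarith [norm_nonneg ((gaugeModes L).starProjection y + (gaugeModes L).starProjection w)]
  · -- stiff block, Young with `ε = κ`; gauge block, Young with `ε = 1 − κ(1 − κ)`
    have h1 := norm_add_sq_ge_young ((stiffSpace L).starProjection y) ((stiffSpace L).starProjection w) hκ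
    have hμ : 0 < 1 - κ * (1 - κ) := by nlinarith
    have h2 := norm_add_sq_ge_young ((gaugeModes L).starProjection w) ((gaugeModes L).starProjection y) hμ
    rw [add_comm ((gaugeModes L).starProjection w)] at h2
    have hb2 : b ^ 2 ≤ κ ^ 2 * a ^ 2 := by
      calc b ^ 2 ≤ (κ * a) ^ 2 := pow_le_pow_left₀ hb0 hleak 2
        _ = κ ^ 2 * a ^ 2 := mul_pow κ a 2
    -- `(1/κ − 1)·b² ≤ κ(1−κ)·a²`
    have hk1 : (1 / κ - 1) * b ^ 2 ≤ κ * (1 - κ) * a ^ 2 := by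
      have e : κ * (1 - κ) * a ^ 2 = (1 / κ - 1) * (κ ^ 2 * a ^ 2) := by field_simp
      rw [e]; exact mul_le_mul_of_nonneg_left hb2 (by rw [sub_nonneg, le_div_iff₀ hκ, one_mul]; exact hκ1.le)
    -- `(1/(1 − κ(1−κ)) − 1) ≤ 4κ/3`
    have hk2 : (1 / (1 - κ * (1 - κ)) - 1) * p ^ 2 ≤ 4 * κ / 3 * p ^ 2 := by
      refine mul_le_mul_of_nonneg_right ?_ (sq_nonneg _)
      rw [div_sub_one hμ.ne', div_le_iff₀ hμ]
      nlinarith [sq_nonneg (1 - 2 * κ), mul_nonneg hκ.le (sub_nonneg.mpr hκ1.le)]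
    nlinarith

end Summit.QuantumFields.YangMills.Theorems.TwistedTraceScaling.Negative.R56

end
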